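import Summits.ValiantsHypothesis.ValiantsHypothesis.Theorems.BarrierLeverPartitionMinorsChowHeightTwo
import Summits.ValiantsHypothesis.ValiantsHypothesis.Theorems.BarrierLeverPartitionMinorsChowSwap
import Summits.ValiantsHypothesis.ValiantsHypothesis.Theorems.BarrierLeverPartitionMinorsChowHeightThreeCertificates
import Summits.ValiantsHypothesis.ValiantsHypothesis.Theorems.BarrierLeverPartitionMinorsChowHeightThreeTable

/-!
# Route BarrierLever — Chow witnesses for partition minors: the conclusion of item 20172 (CPM) for
# EVERY layout of height `h ≤ 3`

Helper file (`--supports stmt-ValiantsHypothesis-20172`; cell valiant-natproofs, rung V4, 𝒟-side of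
door (c); seat val-np-p4 gen 11).  Closes NO item.

The locked-core engine (`chow_height_le_of_lockedCore`) reduces CPM at heights `≤ H₀` to the LOCKED
injective layouts of height `≤ H₀`.  Heights `≤ 2` have no locked pair (`…ChowHeightTwo`).  At height
`3` there are `224` locked pairs, all with `r = 4`, forming `24` orbits under relabelling of the `x`-
and `y`-coordinates and the `x ↔ y` swap (`…ChowHeightThreeTable`: `lockedTable_complete/_sound`,
kernel-checked), and each of the `24` representatives carries an integer Chow witness certified
modulo `101` (`…ChowHeightThreeCertificates`: `rep_hit`).  This file supplies the glue:

* `famC_card`, `cdeg_famC`, `lockedB_famC` — an injective layout `u : Fin r → Finset (Fin 3)` and its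
  coded family; the engine's locked hypothesis is the coded test `lockedB`;
* `actC_famC` — relabelling a layout acts on its coded family by `actC`;
* `exists_perm_of_famC_eq` — layouts with the same coded family differ by a re-indexing (target injective);
* `chow_hit_locked_height_three` — **every locked injective layout pair of height `3` is hit**
  (table lookup; transport of `rep_hit` along `chow_hit_of_perm`, `chow_hit_relabel`, `chow_hit_swap`);
* `chowHits_of_height_le_three` — **for every `h ≤ 3`, every `r` and every injective layout pair
  `u w : Fin r → Finset (Fin h)`, some product of `h + h` affine forms has nonzero partition minor**
  (item 20172's conclusion verbatim at these heights; the item itself asks for all LARGE `h`).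

WHAT THIS IS NOT: the second complete finite height slice of CPM (after `h ≤ 2`), i.e. a kernel
certificate that the `h = 3` locked core — where every universal-witness programme of the cell died —
is hit by Chow witnesses; nothing on items 20172 / 20195 / 19717 themselves, on crux
stmt-ValiantsHypothesis-14610, or on `VP` versus `VNP`.
-/

set_option linter.dupNamespace false

namespace Summit.ValiantsHypothesis.ValiantsHypothesis.Theorems.BarrierLever.ChowFactor

open Finset MvPolynomial

noncomputable section

/-! ## 1. Layouts and their coded families -/

/-- The coded family of an injective layout has `r` members. -/
theorem famC_card {r : ℕ} (u : Fin r → Finset (Fin 3)) (hu : Function.Injective u) :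
    (famC u).card = r := by
  unfold famC
  have hinj : Function.Injective fun i => code3 (u i) := fun i j hij => hu (code3_injective hij)
  rw [Finset.card_image_of_injective _ hinj, Finset.card_univ, Fintype.card_fin]

/-- The coded family of an injective layout is an `r`-subset of `Fin 8`. -/
theorem famC_mem_powersetCard {r : ℕ} (u : Fin r → Finset (Fin 3)) (hu : Function.Injective u) :
    famC u ∈ (Finset.univ : Finset (Fin 8)).powersetCard r := by
  rw [Finset.mem_powersetCard]
  exact ⟨Finset.subset_univ _, famC_card u hu⟩

/-- An injective layout of height `3` has at most `8` rows. -/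
theorem mem_range_nine_of_injective {r : ℕ} (u : Fin r → Finset (Fin 3)) (hu : Function.Injective u) :
    r ∈ Finset.range 9 := by
  rw [Finset.mem_range]
  have h8 := Finset.card_le_univ (famC u)
  rw [famC_card u hu, Fintype.card_fin] at h8
  omega

/-- The coded degree is the size of the `∈`-class of the coordinate. -/
theorem cdeg_famC {r : ℕ} (u : Fin r → Finset (Fin 3)) (hu : Function.Injective u) (a : Fin 3) :
    cdeg (famC u) a = (Finset.univ.filter fun i => a ∈ u i).card := by
  unfold cdeg famC
  have hinj : Function.Injective fun i => code3 (u i) := fun i j hij => hu (code3_injective hij)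
  rw [Finset.filter_image, Finset.card_image_of_injective _ hinj]
  congr 1
  ext i
  simp only [Finset.mem_filter, Finset.mem_univ, true_and, decode3_code3]

/-- The engine's locked hypothesis implies the coded locked test. -/
theorem lockedB_famC {r : ℕ} (u w : Fin r → Finset (Fin 3)) (hu : Function.Injective u)
    (hw : Function.Injective w)
    (hlk : ∀ (a c : Fin 3) (β γ : Bool),
      (Finset.univ.filter fun i => (a ∈ u i ↔ β = true)).card ≠
        (Finset.univ.filter fun j => (c ∈ w j ↔ γ = true)).card) :
    lockedB (famC u) (famC w) = true := by
  unfold lockedB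
  rw [decide_eq_true_eq]
  intro a c
  rw [cdeg_famC u hu, cdeg_famC w hw, famC_card u hu]
  refine ⟨?_, ?_⟩
  · have h1 := hlk a c true true
    rw [card_filter_iff_eq, card_filter_iff_eq, if_pos rfl, if_pos rfl] at h1
    exact h1
  · have h2 := hlk a c true false
    rw [card_filter_iff_eq, card_filter_iff_eq, if_pos rfl, if_neg Bool.false_ne_true] at h2
    have hwc := card_filter_mem_add_card_filter_not_mem w c
    omega

/-- Relabelling a layout acts on its coded family by `actC`. -/
theorem actC_famC {r : ℕ} (π : Equiv.Perm (Fin 3)) (u : Fin r → Finset (Fin 3)) :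
    actC π (famC u) = famC (fun i => (u i).map π.toEmbedding) := by
  unfold actC famC
  rw [Finset.image_image]
  congr 1
  funext i
  simp only [Function.comp_apply, decode3_code3]

/-- Two injective layouts with the same coded family differ by a re-indexing. -/
theorem exists_perm_of_famC_eq {r : ℕ} (f g : Fin r → Finset (Fin 3))
    (hg : Function.Injective g) (e : famC f = famC g) :
    ∃ σ : Equiv.Perm (Fin r), ∀ i, f (σ i) = g i := by
  classical
  have hex : ∀ i, ∃ j, f j = g i := by
    intro i
    have hi : code3 (g i) ∈ famC f := by
      rw [e]
      exact Finset.mem_image_of_mem _ (Finset.mem_univ i)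
    obtain ⟨j, -, hj⟩ := Finset.mem_image.mp hi
    exact ⟨j, code3_injective hj⟩
  choose s hs using hex
  have hsinj : Function.Injective s := fun i i' hii => hg (by rw [← hs i, ← hs i', hii])
  exact ⟨Equiv.ofBijective s (Finite.injective_iff_bijective.mp hsinj), fun i => hs i⟩

/-- Relabelling by `π` and then by `π⁻¹` is the identity on a face. -/
theorem map_map_symm_perm (π : Equiv.Perm (Fin 3)) (S : Finset (Fin 3)) :
    (S.map π.toEmbedding).map π.symm.toEmbedding = S := by
  ext a
  simp

/-- The representatives' coded families are the table's normal forms (rows). -/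
theorem famC_repU : ∀ k : Fin 24, famC (repU k) = repUC k := by decide +kernel

/-- The representatives' coded families are the table's normal forms (columns). -/
theorem famC_repW : ∀ k : Fin 24, famC (repW k) = repWC k := by decide +kernel

/-- The representative row layouts are injective. -/
theorem repU_injective : ∀ k : Fin 24, Function.Injective (repU k) := by decide +kernel

/-- The representative column layouts are injective. -/
theorem repW_injective : ∀ k : Fin 24, Function.Injective (repW k) := by decide +kernel

/-- Transport of a hit along pointwise equal layouts. -/
theorem chow_hit_congr {h r : ℕ} {u₁ u₂ w₁ w₂ : Fin r → Finset (Fin h)} (hu : ∀ i, u₁ i = u₂ i)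
    (hw : ∀ j, w₁ j = w₂ j)
    (hhit : ∃ ℓ : Fin (h + h) → MvPolynomial (Fin (h + h)) ℂ, (∀ q, (ℓ q).totalDegree ≤ 1) ∧
      (Matrix.of fun i j : Fin r => coeff
        (∑ b ∈ u₁ i, Finsupp.single (Fin.castAdd h b) 1 + ∑ d ∈ w₁ j, Finsupp.single (Fin.natAdd h d) 1)
        (∏ q, ℓ q)).det ≠ 0) :
    ∃ ℓ : Fin (h + h) → MvPolynomial (Fin (h + h)) ℂ, (∀ q, (ℓ q).totalDegree ≤ 1) ∧
      (Matrix.of fun i j : Fin r => coeff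
        (∑ b ∈ u₂ i, Finsupp.single (Fin.castAdd h b) 1 + ∑ d ∈ w₂ j, Finsupp.single (Fin.natAdd h d) 1)
        (∏ q, ℓ q)).det ≠ 0 := by
  have e1 : u₁ = u₂ := funext hu
  have e2 : w₁ = w₂ := funext hw
  subst e1 e2
  exact hhit

/-! ## 2. Every locked layout of height `3` is hit -/

/-- **Every LOCKED injective layout pair of height `3` is hit by a product of `3 + 3` affine forms**:
its coded family pair is a table entry (`lockedTable_complete`), whose normalising data carry it to
a certified representative (`lockedTable_sound`, `rep_hit`); the hit is transported back along
re-indexing, the `x ↔ y` swap and coordinate relabelling. -/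
theorem chow_hit_locked_height_three {r : ℕ} (u w : Fin r → Finset (Fin 3))
    (hu : Function.Injective u) (hw : Function.Injective w)
    (hlk : ∀ (a c : Fin 3) (β γ : Bool),
      (Finset.univ.filter fun i => (a ∈ u i ↔ β = true)).card ≠
        (Finset.univ.filter fun j => (c ∈ w j ↔ γ = true)).card) :
    ∃ ℓ : Fin (3 + 3) → MvPolynomial (Fin (3 + 3)) ℂ, (∀ q, (ℓ q).totalDegree ≤ 1) ∧
      (Matrix.of fun i j : Fin r => coeff
        (∑ b ∈ u i, Finsupp.single (Fin.castAdd 3 b) 1 + ∑ d ∈ w j, Finsupp.single (Fin.natAdd 3 d) 1)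
        (∏ q, ℓ q)).det ≠ 0 := by
  classical
  obtain ⟨e, he, heU, heW⟩ := lockedTable_complete r (mem_range_nine_of_injective u hu) (famC u)
    (famC_mem_powersetCard u hu) (famC w) (famC_mem_powersetCard w hw) (lockedB_famC u w hu hw hlk)
  have hnf := lockedTable_sound e he
  obtain ⟨U, W, gπ, gρ, sw, k⟩ := e
  simp only at heU heW hnf
  subst heU
  subst heW
  -- the relabelled layouts
  have hu'i : Function.Injective (fun i => (u i).map (perm3 gπ).toEmbedding) :=
    fun i j hij => hu (Finset.map_injective _ hij)
  have hw'i : Function.Injective (fun j => (w j).map (perm3 gρ).toEmbedding) :=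
    fun i j hij => hw (Finset.map_injective _ hij)
  -- undoing the relabelling
  have hback : (∃ ℓ : Fin (3 + 3) → MvPolynomial (Fin (3 + 3)) ℂ, (∀ q, (ℓ q).totalDegree ≤ 1) ∧
      (Matrix.of fun i j : Fin r => coeff
        (∑ b ∈ (fun i => (u i).map (perm3 gπ).toEmbedding) i, Finsupp.single (Fin.castAdd 3 b) 1 +
          ∑ d ∈ (fun j => (w j).map (perm3 gρ).toEmbedding) j, Finsupp.single (Fin.natAdd 3 d) 1)
        (∏ q, ℓ q)).det ≠ 0) →
      ∃ ℓ : Fin (3 + 3) → MvPolynomial (Fin (3 + 3)) ℂ, (∀ q, (ℓ q).totalDegree ≤ 1) ∧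
      (Matrix.of fun i j : Fin r => coeff
        (∑ b ∈ u i, Finsupp.single (Fin.castAdd 3 b) 1 + ∑ d ∈ w j, Finsupp.single (Fin.natAdd 3 d) 1)
        (∏ q, ℓ q)).det ≠ 0 := fun hh =>
    chow_hit_congr (fun i => map_map_symm_perm (perm3 gπ) (u i))
      (fun j => map_map_symm_perm (perm3 gρ) (w j))
      (chow_hit_relabel (perm3 gπ).symm (perm3 gρ).symm _ _ hh)
  apply hback
  cases sw
  · -- no swap: rows go to the representative rows, columns to the representative columns
    simp only [entryNF, Bool.false_eq_true, if_false, Prod.mk.injEq] at hnf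
    rw [actC_famC, actC_famC, ← famC_repU, ← famC_repW] at hnf
    obtain ⟨h1, h2⟩ := hnf
    have hr : r = 4 := by
      have hc := famC_card _ hu'i
      rw [h1, famC_card _ (repU_injective k)] at hc
      exact hc.symm
    subst hr
    obtain ⟨σ, hσ⟩ := exists_perm_of_famC_eq _ _ (repU_injective k) h1
    obtain ⟨τ, hτ⟩ := exists_perm_of_famC_eq _ _ (repW_injective k) h2
    exact chow_hit_of_perm _ _ σ τ
      (chow_hit_congr (fun i => (hσ i).symm) (fun j => (hτ j).symm) (rep_hit k))
  · -- swap: columns go to the representative rows, rows to the representative columns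
    simp only [entryNF, if_true, Prod.mk.injEq] at hnf
    rw [actC_famC, actC_famC, ← famC_repU, ← famC_repW] at hnf
    obtain ⟨h1, h2⟩ := hnf
    have hr : r = 4 := by
      have hc := famC_card _ hw'i
      rw [h1, famC_card _ (repU_injective k)] at hc
      exact hc.symm
    subst hr
    obtain ⟨σ, hσ⟩ := exists_perm_of_famC_eq _ _ (repU_injective k) h1
    obtain ⟨τ, hτ⟩ := exists_perm_of_famC_eq _ _ (repW_injective k) h2
    exact chow_hit_swap _ _ (chow_hit_of_perm _ _ σ τ
      (chow_hit_congr (fun i => (hσ i).symm) (fun j => (hτ j).symm) (rep_hit k)))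

/-! ## 3. CPM for every layout of height `≤ 3` -/

/-- **Item 20172's conclusion for every injective layout pair of height `h ≤ 3`, every `r`.** -/
theorem chowHits_of_height_le_three (h r : ℕ) (hh : h ≤ 3) (u w : Fin r → Finset (Fin h))
    (hu : Function.Injective u) (hw : Function.Injective w) :
    ∃ ℓ : Fin (h + h) → MvPolynomial (Fin (h + h)) ℂ, (∀ q, (ℓ q).totalDegree ≤ 1) ∧
      (Matrix.of fun i j : Fin r => coeff
        (∑ b ∈ u i, Finsupp.single (Fin.castAdd h b) 1 + ∑ d ∈ w j, Finsupp.single (Fin.natAdd h d) 1)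
        (∏ q, ℓ q)).det ≠ 0 := by
  classical
  refine chow_height_le_of_lockedCore 3 (fun h r hh3 u w hu hw hlk => ?_) h hh r u w hu hw
  rcases (by omega : h = 0 ∨ h = 1 ∨ h = 2 ∨ h = 3) with rfl | rfl | rfl | rfl
  · exact chow_hit_height_zero r u w hu
  · exfalso
    obtain ⟨a, c, hac⟩ := unlocked_height_one (Finset.univ.image u) (Finset.univ.image w)
      (by rw [Finset.card_image_of_injective _ hu, Finset.card_image_of_injective _ hw])
    exact not_locked_of_families u w hu hw a c hac hlk
  · exfalso
    obtain ⟨a, c, hac⟩ := unlocked_height_two (Finset.univ.image u) (Finset.univ.image w)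
      (by rw [Finset.card_image_of_injective _ hu, Finset.card_image_of_injective _ hw])
    exact not_locked_of_families u w hu hw a c hac hlk
  · exact chow_hit_locked_height_three u w hu hw hlk

end

end Summit.ValiantsHypothesis.ValiantsHypothesis.Theorems.BarrierLever.ChowFactor
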